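import Mathlib
import Summits.NavierStokesRegularity.NavierStokesRegularity.Theorems.TaoLadderRungTwoBreakBlowupRigidityOneRayReduction
import Summits.NavierStokesRegularity.NavierStokesRegularity.Theorems.TaoLadderRungTwoBreakBlowupRigidityOneVoidTables
import HarnessLib

/-!
# RAY EMBEDDING OF DSS WAVES: every admissible DSS blow-up wave of the dyadic member rides on every normalised INVARIANT
  RAY of a cancelling table (same delay, profiles `(Φ_r)₀ · u`) — so K1(1) `TaoLadderRungTwoBreak.NoSurvivingDSSOne`
  ⟨20205⟩ on a ray table CONTAINS its dyadic slice, and the CONCLUSION class of K2(1) `BlowupRigidityOne` ⟨20206⟩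
  (non-trivial (S₁)-surviving admissible DSS waves) on a ray table contains the dyadic one (`--supports`)

MODEL lattice ODEs only (Tao 2016 §1.2, §4 Lemma 4.1 (iii) (4.8) in self-similar variables, §6.4); nothing here is a
statement about the Navier–Stokes equations; NO item is closed.  DEF-FREE; ROUTE-INDEPENDENT.  Completes the ray
dictionary of this hand: pseudo-solutions (`…RayReduction`), eternal solutions
(`…NoSurvivingEternalViscBddOneRayEmbedding`), DSS waves (here).

* `hasDerivAt_apply_of_dssWave_dyadic`, `dssWave_dyadic_apply_ne_zero` — the component profile law of a dyadic DSS wave, and the vanishing of the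
  idle components `i ≠ 0` of every admissible dyadic DSS wave (undriven: `f' = −f`, mass clause);
* `isDSSWave_ray_of_dyadic` — for a normalised invariant ray `u` of `α`: `IsDSSWave ε₀ dyadicTable π T Φ →
  IsDSSWave ε₀ α π T (fun r x => (Φ r x 0) • u)`;
* `ray_nontrivial_iff` — the ray wave is non-trivial iff the dyadic wave is (`u ≠ 0`);
* `noSurvivingDSS_dyadic_of_ray` — BY SHAPE: «every (S_a)-surviving admissible DSS wave of α is trivial» implies the same
  for the dyadic member; `survivingDSSWave_ray_of_dyadic` — a non-trivial surviving dyadic wave yields one of `α`.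

HONEST LABEL: dictionary work; no stub, crux, rung or summit is proved; rung 0.
-/

noncomputable section

-- the summit and its single sub-problem share the name (CONVENTIONS §1)
set_option linter.dupNamespace false

open Set Filter Topology MeasureTheory
open scoped RealInnerProductSpace

namespace Summit.NavierStokesRegularity.NavierStokesRegularity.Theorems

namespace BlowupRigidityOne

open Literature.Analysis.FluidPDE Literature.Analysis.FluidPDE.TaoCascade

variable {m : ℕ} {ε₀ : ℝ} {α : Fin m → Fin m → Fin m → ℤ × ℤ × ℤ → ℝ} {u : Em m}
variable {ρ : Type*} [Fintype ρ] {π : Equiv.Perm ρ} {T : ℝ} {Φ : ρ → ℝ → Em 4}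

/-! ## The dyadic forms and the components of a dyadic DSS wave -/

/-- Components of the profile law of a dyadic DSS wave: component `0` obeys
`f' = −f + Λ (Φ_{π⁻¹r}(x+T))₀² − Λ⁻¹ (Φ_{πr}(x−T))₀ (Φ_r(x))₀`, every other component obeys `f' = −f`.
[cite: Tao2016AveragedNS, §1.2, §4 Lemma 4.1 (iii) (4.8) in self-similar variables; cell vocabulary (`IsDSSWave`)] -/
theorem hasDerivAt_apply_of_dssWave_dyadic (hW : IsDSSWave ε₀ dyadicTable π T Φ) (r : ρ) (x : ℝ) (i : Fin 4) :
    HasDerivAt (fun x => Φ r x i)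
      (-(Φ r x i) + (if i = 0 then bigLam ε₀ * (Φ (π.symm r) (x + T) 0 * Φ (π.symm r) (x + T) 0)
        - (bigLam ε₀)⁻¹ * (Φ (π r) (x - T) 0 * Φ r x 0) else 0)) x := by
  -- the dyadic forms (cf. `WakeRatchetDyadicFront.qform_dyadicTable`, not imported to stay route-independent)
  have qform_dyadicTable : ∀ (μ : ℤ × ℤ × ℤ) (y x : Em 4) (j : Fin 4),
      qform dyadicTable μ y x j = if j = 0 then dyadicTable 0 0 0 μ * (y 0 * x 0) else 0 := by
    intro μ y x j
    unfold qform
    split_ifs with hj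
    · subst hj
      rw [Fintype.sum_eq_single (0 : Fin 4) (fun i₁ hi₁ => Finset.sum_eq_zero fun i₂ _ => by
          have : ¬ (i₁ = 0 ∧ i₂ = 0 ∧ (0 : Fin 4) = 0) := fun h => hi₁ h.1
          simp [dyadicTable_of_not this])]
      rw [Fintype.sum_eq_single (0 : Fin 4) (fun i₂ hi₂ => by
          have : ¬ ((0 : Fin 4) = 0 ∧ i₂ = 0 ∧ (0 : Fin 4) = 0) := fun h => hi₂ h.2.1
          simp [dyadicTable_of_not this])]
    · refine Finset.sum_eq_zero fun i₁ _ => Finset.sum_eq_zero fun i₂ _ => ?_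
      have : ¬ (i₁ = 0 ∧ i₂ = 0 ∧ j = 0) := fun h => hj h.2.2
      simp [dyadicTable_of_not this]
  have h := ((EuclideanSpace.proj i : Em 4 →L[ℝ] ℝ).hasFDerivAt.comp_hasDerivAt x (hW.wave r x))
  have e : (EuclideanSpace.proj i : Em 4 →L[ℝ] ℝ) (-((1 : ℝ) • Φ r x) + tableQ dyadicTable (Φ r x)
      + bigLam ε₀ • tableA dyadicTable (Φ (π.symm r) (x + T))
      + (bigLam ε₀)⁻¹ • tableB dyadicTable (Φ (π r) (x - T)) (Φ r x))
      = -(Φ r x i) + (if i = 0 then bigLam ε₀ * (Φ (π.symm r) (x + T) 0 * Φ (π.symm r) (x + T) 0)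
        - (bigLam ε₀)⁻¹ * (Φ (π r) (x - T) 0 * Φ r x 0) else 0) := by
    rw [EuclideanSpace.coe_proj]
    simp only [PiLp.add_apply, PiLp.neg_apply, PiLp.smul_apply, smul_eq_mul, one_mul, tableQ_apply, tableA_apply,
      tableB_apply, qform_dyadicTable]
    split_ifs with hi
    · simp only [dyadicTable]; norm_num; ring
    · ring
  rw [e] at h
  exact h

/-- **The idle components of an admissible dyadic DSS wave vanish**: for `i ≠ 0`, `(Φ_r)_i' = −(Φ_r)_i`, so
`(Φ_r(x))_i = (Φ_r(0))_i e^{−x}`, and the integrable-mass clause forces `(Φ_r)_i ≡ 0`.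
[cite: Tao2016AveragedNS, §1.2, §4 Lemma 4.1 (iii) (4.8); cell vocabulary (`IsDSSWave`, clause `mass`)] -/
theorem dssWave_dyadic_apply_ne_zero (hW : IsDSSWave ε₀ dyadicTable π T Φ) (r : ρ) {i : Fin 4} (hi : i ≠ 0)
    (x : ℝ) : Φ r x i = 0 := by
  have hder : ∀ x, HasDerivAt (fun x => Φ r x i) (-(Φ r x i)) x := by
    intro x
    have h := hasDerivAt_apply_of_dssWave_dyadic hW r x i
    rw [if_neg hi, add_zero] at h
    exact h
  have hconst : ∀ x, Real.exp x * Φ r x i = Φ r 0 i := by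
    intro x
    have hd : ∀ w, HasDerivAt (fun w => Real.exp w * Φ r w i) 0 w := by
      intro w
      have h1 := (Real.hasDerivAt_exp w).mul (hder w)
      have e : Real.exp w * Φ r w i + Real.exp w * -(Φ r w i) = 0 := by ring
      rw [e] at h1
      exact h1
    have h := is_const_of_deriv_eq_zero (f := fun w => Real.exp w * Φ r w i)
      (fun w => (hd w).differentiableAt) (fun w => (hd w).deriv) x 0
    simpa using h
  have hform : ∀ x, Φ r x i = Φ r 0 i * Real.exp (-x) := by
    intro x
    have h := hconst x
    have hexp : Real.exp x * Real.exp (-x) = 1 := by rw [← Real.exp_add, add_neg_cancel, Real.exp_zero]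
    calc Φ r x i = Real.exp x * Φ r x i * Real.exp (-x) := by rw [mul_comm (Real.exp x), mul_assoc, hexp, mul_one]
      _ = Φ r 0 i * Real.exp (-x) := by rw [h]
  have h0 : Φ r 0 i = 0 := by
    by_contra hne
    have hint : Integrable (fun x => Φ r x i) := by
      refine hW.mass.mono' ?_ (Eventually.of_forall fun x => ?_)
      · exact (continuous_iff_continuousAt.2 fun x => (hder x).continuousAt).aestronglyMeasurable
      · rw [Real.norm_eq_abs]
        exact (abs_apply_le_norm (Φ r x) i).trans
          (Finset.single_le_sum (f := fun r' => ‖Φ r' x‖) (fun r' _ => norm_nonneg _) (Finset.mem_univ r))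
    have heq : (fun x => Φ r x i) = fun x => Φ r 0 i * Real.exp (-x) := funext hform
    rw [heq] at hint
    have hexp : Integrable (fun x : ℝ => Real.exp (-x)) := by
      have := hint.const_mul ((Φ r 0 i)⁻¹)
      refine this.congr (Eventually.of_forall fun x => ?_)
      simp only
      rw [← mul_assoc, inv_mul_cancel₀ hne, one_mul]
    exact not_integrable_exp_neg hexp
  rw [hform x, h0, zero_mul]

/-- On an admissible dyadic DSS wave every profile norm is `|(Φ_r)₀|`, so `‖(Φ_r(x))₀ · u‖ = ‖Φ_r(x)‖ ‖u‖`.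
[cite: Tao2016AveragedNS, §1.2; cell vocabulary] -/
theorem norm_rayProfile (hW : IsDSSWave ε₀ dyadicTable π T Φ) (u : Em m) (r : ρ) (x : ℝ) :
    ‖(Φ r x 0) • u‖ = ‖Φ r x‖ * ‖u‖ := by
  rw [norm_smul, Real.norm_eq_abs]
  congr 1
  have h1 : Φ r x 1 = 0 := dssWave_dyadic_apply_ne_zero hW r (by decide) x
  have h2 : Φ r x 2 = 0 := dssWave_dyadic_apply_ne_zero hW r (by decide) x
  have h3 : Φ r x 3 = 0 := dssWave_dyadic_apply_ne_zero hW r (by decide) x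
  rw [EuclideanSpace.norm_eq, Fin.sum_univ_four, h1, h2, h3]
  simp only [Real.norm_eq_abs, abs_zero, ne_eq, OfNat.ofNat_ne_zero, not_false_eq_true, zero_pow, add_zero]
  exact (Real.sqrt_sq (abs_nonneg _)).symm

/-! ## Dyadic DSS waves ride on invariant rays -/

/-- **THE RAY EMBEDDING OF DSS WAVES.**  For a normalised invariant ray `u` of `α` (`Q u = 0`, `A u = u`, `B(u,u) = −u`),
every admissible DSS wave `(π, T, Φ)` of the dyadic member yields the admissible DSS wave `(π, T, (Φ_r)₀·u)` of `α`:
same delay, the profile law holds (the dyadic scalar profile law times `u`), summed mass `× ‖u‖`, renormalised energy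
`× ‖u‖²`.
[cite: Tao2016AveragedNS, §1.2, §4 Lemma 4.1 (iii) (4.8) in self-similar variables; cell vocabulary (`IsDSSWave`, invariant ray)] -/
theorem isDSSWave_ray_of_dyadic (hQ : tableQ α u = 0) (hA : tableA α u = u) (hB : tableB α u u = -u)
    (hW : IsDSSWave ε₀ dyadicTable π T Φ) : IsDSSWave ε₀ α π T (fun r x => (Φ r x 0) • u) where
  delay_pos := hW.delay_pos
  wave r x := by
    have hd := (hasDerivAt_apply_of_dssWave_dyadic hW r x 0).smul_const u
    simp only [if_true] at hd
    refine hd.congr_deriv ?_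
    ext i
    have h1 := (tables_smul α u (Φ r x 0) (Φ (π r) (x - T) 0) i).1
    have h2 := (tables_smul α u (Φ (π.symm r) (x + T) 0) 0 i).2.1
    have h3 := (tables_smul α u (Φ r x 0) (Φ (π r) (x - T) 0) i).2.2
    have hQi : tableQ α u i = 0 := by rw [hQ]; rfl
    have hAi : tableA α u i = u i := by rw [hA]
    have hBi : tableB α u u i = -u i := by rw [hB]; rfl
    simp only [PiLp.add_apply, PiLp.neg_apply, PiLp.smul_apply, smul_eq_mul, h1, h2, h3, hQi, hAi, hBi]
    ring
  mass := by
    have hcont : ∀ r, Continuous fun x => (Φ r x 0) • u := fun r =>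
      continuous_iff_continuousAt.2 fun x => ((hasDerivAt_apply_of_dssWave_dyadic hW r x 0).smul_const u).continuousAt
    have hmeas : AEStronglyMeasurable (sMass fun r x => (Φ r x 0) • u) volume := by
      unfold sMass
      exact (continuous_finsetSum _ fun r _ => (hcont r).norm).aestronglyMeasurable
    refine (hW.mass.mul_const ‖u‖).mono' hmeas (Eventually.of_forall fun x => ?_)
    unfold sMass
    rw [Real.norm_eq_abs, abs_of_nonneg (Finset.sum_nonneg fun r _ => norm_nonneg _), Finset.sum_mul]
    exact Finset.sum_le_sum fun r _ => by rw [norm_rayProfile hW u r x]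
  bdd := by
    obtain ⟨x₀, P, hP⟩ := hW.bdd
    refine ⟨x₀, P * ‖u‖ ^ 2, fun x hx => ?_⟩
    have h := hP x hx
    unfold wEnergy sEnergy at h ⊢
    have hs : ∑ r, ‖(Φ r x 0) • u‖ ^ 2 = (∑ r, ‖Φ r x‖ ^ 2) * ‖u‖ ^ 2 := by
      rw [Finset.sum_mul]
      exact Finset.sum_congr rfl fun r _ => by rw [norm_rayProfile hW u r x, mul_pow]
    rw [hs, ← mul_assoc]
    exact mul_le_mul_of_nonneg_right h (sq_nonneg _)

/-- The ray wave is non-trivial iff the dyadic wave is (`u ≠ 0`).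
[cite: Tao2016AveragedNS, §1.2; cell vocabulary] -/
theorem ray_nontrivial_iff (hW : IsDSSWave ε₀ dyadicTable π T Φ) (hu : u ≠ 0) :
    (∃ r x, (fun r x => (Φ r x 0) • u) r x ≠ 0) ↔ ∃ r x, Φ r x ≠ 0 := by
  constructor
  · rintro ⟨r, x, h⟩
    refine ⟨r, x, fun h0 => h ?_⟩
    simp [h0]
  · rintro ⟨r, x, h⟩
    refine ⟨r, x, fun h0 => h ?_⟩
    have h00 : Φ r x 0 = 0 := by
      rcases smul_eq_zero.1 h0 with h1 | h1
      · exact h1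
      · exact absurd h1 hu
    have hn : ‖Φ r x‖ = 0 := by
      have := norm_rayProfile hW u r x
      rw [h00, zero_smul, norm_zero] at this
      rcases mul_eq_zero.1 this.symm with h1 | h1
      · exact h1
      · exact absurd (norm_eq_zero.1 h1) hu
    exact norm_eq_zero.1 hn

/-- **A non-trivial (S_a)-surviving admissible DSS wave of the dyadic member yields one of `α`** along every normalised
invariant ray `u ≠ 0` — the CONCLUSION class of K2(1) on a ray table contains the dyadic one.
[cite: Tao2016AveragedNS, §1.2, §4 Lemma 4.1 (iii) (4.8); cell vocabulary (`IsDSSWave`, `Surviving`, invariant ray)] -/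
theorem survivingDSSWave_ray_of_dyadic {a : ℝ} (hQ : tableQ α u = 0) (hA : tableA α u = u)
    (hB : tableB α u u = -u) (hu : u ≠ 0) (hW : IsDSSWave ε₀ dyadicTable π T Φ) (hS : Surviving a ε₀ T)
    (hne : ∃ r x, Φ r x ≠ 0) :
    ∃ Ψ : ρ → ℝ → Em m, IsDSSWave ε₀ α π T Ψ ∧ Surviving a ε₀ T ∧ ∃ r x, Ψ r x ≠ 0 :=
  ⟨fun r x => (Φ r x 0) • u, isDSSWave_ray_of_dyadic hQ hA hB hW, hS, (ray_nontrivial_iff hW hu).2 hne⟩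

/-- **K1(1)-type statements on a ray table contain their dyadic slice, BY SHAPE**: if every (S_a)-surviving admissible
DSS wave of `α` (shape permutation on `Fin q`) is trivial, then so is every (S_a)-surviving admissible DSS wave of the
dyadic member.
[cite: Tao2016AveragedNS, §4 Thm. 4.2 (statement shape), §6.4; cell vocabulary (`NoSurvivingDSS`, invariant ray)] -/
theorem noSurvivingDSS_dyadic_of_ray {a : ℝ} (hQ : tableQ α u = 0) (hA : tableA α u = u) (hB : tableB α u u = -u)
    (hu : u ≠ 0)
    (h : ∀ (q : ℕ) (π : Equiv.Perm (Fin q)) (T : ℝ) (Ψ : Fin q → ℝ → Em m),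
      IsDSSWave ε₀ α π T Ψ → Surviving a ε₀ T → ∀ r x, Ψ r x = 0)
    (q : ℕ) (π : Equiv.Perm (Fin q)) (T : ℝ) (Φ : Fin q → ℝ → Em 4) (hW : IsDSSWave ε₀ dyadicTable π T Φ)
    (hS : Surviving a ε₀ T) : ∀ r x, Φ r x = 0 := by
  by_contra hne
  push Not at hne
  obtain ⟨r, x, hrx⟩ := hne
  obtain ⟨Ψ, hΨ, -, r', x', hne'⟩ := survivingDSSWave_ray_of_dyadic hQ hA hB hu hW hS ⟨r, x, hrx⟩
  exact hne' (h q π T Ψ hΨ hS r' x')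

end BlowupRigidityOne

end Summit.NavierStokesRegularity.NavierStokesRegularity.Theorems

end
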